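import Summits.AtomisticToContinuum.HydrodynamicLimit.Theorems.LambertianContactSwapLambertianWellPosedFluxLaw
import Summits.AtomisticToContinuum.HydrodynamicLimit.Theorems.LambertianContactSwapLambertianWellPosedKick

/-!
# Lebesgue measure on the billiard good set in collision coordinates; the redraw preserves it

Helper file (`--supports`) of the support item `LambertianWellPosed` of route `LambertianContactSwap`
(`AtomisticToContinuum/HydrodynamicLimit`, stmt-AtomisticToContinuum-12101); part of the chain
HalfAngle → FluxLaw → Cylinder → PhaseLift → JInv proving that the Lambertian pre-kick of a pair preserves
`vol ⊗ γ` on the good pair data (the cosine law of the redraw). See the docstrings of the declarations.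
-/

noncomputable section

open MeasureTheory ProbabilityTheory Set Function Filter Metric
open scoped ENNReal InnerProductSpace Real

namespace Summit.AtomisticToContinuum.HydrodynamicLimit.Theorems

open Literature.MathematicalPhysics.KineticTheory Literature.Analysis.FluidPDE
  Literature.Analysis.FluidPDE.Alexander

open LWindow

namespace HalfAngle

/-! ## The billiard good set in collision-cylinder coordinates -/

section Cylinder

variable {W : Type*} [NormedAddCommGroup W] [InnerProductSpace ℝ W]

/-- **The billiard good set is the incoming collision cylinder**: for every relative velocity `w`,
`{q | (q, w) ∈ billiardGood ε} = collisionCylRegion ε (-w)` — the relative positions from which the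
pair hits transversally are exactly the points `ε ν − τ w`, `⟪w, ν⟫ < 0`, `τ > 0`. [folklore] -/
theorem setOf_mem_billiardGood_eq {ε : ℝ} (hε : 0 < ε) (w : W) :
    {q : W | (q, w) ∈ (billiardGood ε : Set (W × W))} = collisionCylRegion ε (-w) := by
  ext q
  simp only [mem_setOf_eq, collisionCylRegion, mem_image, mem_collisionCylDom, collisionCylMap]
  constructor
  · intro hq
    set τ₀ := pairHitTime ε q w with hτ₀
    set n := hitPoint ε (q, w) with hn
    have hnn : ‖n‖ = ε := norm_hitPoint hε.le hq
    have hτpos : 0 < τ₀ := pairHitTime_pos hε.le hq.1 (PairHits.of_mem_billiardGood hq)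
    refine ⟨(τ₀ / ε) • n, ?_, ?_⟩
    · rw [inner_smul_right, inner_neg_left]
      exact mul_pos (div_pos hτpos hε) (neg_pos.2 (by rw [real_inner_comm]; exact inner_hitPoint_neg hq))
    · have hy : ‖(τ₀ / ε) • n‖ = τ₀ := by
        rw [norm_smul, hnn, Real.norm_of_nonneg (div_pos hτpos hε).le, div_mul_cancel₀ _ hε.ne']
      rw [hy, smul_smul, div_mul_div_cancel₀ hτpos.ne', div_self hε.ne', one_smul, smul_neg, hn, hitPoint]
      simp only
      rw [hτ₀]; abel
  · rintro ⟨y, hy, rfl⟩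
    have hy0 : y ≠ 0 := fun h => by rw [h, inner_zero_right] at hy; exact lt_irrefl _ hy
    have hyn : 0 < ‖y‖ := norm_pos_iff.2 hy0
    set ν := ‖y‖⁻¹ • y with hν
    have hν1 : ‖ν‖ = 1 := by rw [hν, norm_smul, norm_inv, norm_norm, inv_mul_cancel₀ hyn.ne']
    have hwν : ⟪w, ν⟫_ℝ < 0 := by
      rw [hν, inner_smul_right]
      rw [inner_neg_left] at hy
      exact mul_neg_of_pos_of_neg (inv_pos.2 hyn) (by linarith)
    have heq : (ε / ‖y‖) • y + ‖y‖ • -w = ε • ν - ‖y‖ • w := by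
      rw [hν, smul_smul, smul_neg, sub_eq_add_neg, div_eq_mul_inv]
    rw [heq]
    exact (billiardGood_of_cylinder hε hν1 hwν hyn).1


/-- `ℝ³` has dimension `3`. [folklore] -/
theorem finrank_E3 : Module.finrank ℝ (EuclideanSpace ℝ (Fin 3)) = 3 := by
  rw [finrank_euclideanSpace, Fintype.card_fin]

/-- The billiard good set of `ℝ³ × ℝ³` is measurable. [folklore] -/
theorem measurableSet_billiardGood (ε : ℝ) :
    MeasurableSet (billiardGood ε : Set (EuclideanSpace ℝ (Fin 3) × EuclideanSpace ℝ (Fin 3))) :=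
  (isOpen_billiardGood ε).measurableSet

/-- **Lebesgue measure on the billiard good set in incoming collision coordinates**: for measurable
`F ≥ 0` on `ℝ³ × ℝ³`,
`∫_{billiardGood ε} F = ∫_{S²} dσ(ν) ∫_{τ>0} dτ ∫ dw ε² (−⟪w, ν⟫)₊ F(ε ν − τ w, w)`
(Tonelli, the section `{q | (q, w) ∈ billiardGood ε} = collisionCylRegion ε (−w)` and the collision
cylinder formula `Literature.Analysis.FluidPDE.lintegral_collisionCylinder`). [folklore] -/
theorem lintegral_billiardGood_eq_cylinder {ε : ℝ} (hε : 0 < ε)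
    {F : EuclideanSpace ℝ (Fin 3) × EuclideanSpace ℝ (Fin 3) → ℝ≥0∞} (hF : Measurable F) :
    ∫⁻ z in billiardGood ε, F z =
      ∫⁻ ν : sphere (0 : EuclideanSpace ℝ (Fin 3)) 1, (∫⁻ τ in Ioi (0 : ℝ), ∫⁻ w,
        ENNReal.ofReal (ε ^ 2) * (ENNReal.ofReal (-⟪w, (ν : EuclideanSpace ℝ (Fin 3))⟫_ℝ) *
          F (ε • (ν : EuclideanSpace ℝ (Fin 3)) - τ • w, w))) ∂(volume.toSphere) := by
  have hbG := measurableSet_billiardGood ε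
  -- the joint integrand, made opaque
  obtain ⟨K, hK⟩ : ∃ K : EuclideanSpace ℝ (Fin 3) → sphere (0 : EuclideanSpace ℝ (Fin 3)) 1 → ℝ → ℝ≥0∞,
      K = fun (w : EuclideanSpace ℝ (Fin 3)) (ν : sphere (0 : EuclideanSpace ℝ (Fin 3)) 1) (τ : ℝ) =>
        ENNReal.ofReal (ε ^ 2) * (ENNReal.ofReal (-⟪w, (ν : EuclideanSpace ℝ (Fin 3))⟫_ℝ) *
          F (ε • (ν : EuclideanSpace ℝ (Fin 3)) - τ • w, w)) := ⟨_, rfl⟩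
  have hKm : Measurable fun p : (EuclideanSpace ℝ (Fin 3) × sphere (0 : EuclideanSpace ℝ (Fin 3)) 1) × ℝ =>
      K p.1.1 p.1.2 p.2 := by
    rw [hK]
    refine measurable_const.mul ((((measurable_fst.comp measurable_fst).inner
      (measurable_subtype_coe.comp (measurable_snd.comp measurable_fst))).neg.ennreal_ofReal).mul
        (hF.comp ?_))
    exact (((measurable_subtype_coe.comp (measurable_snd.comp measurable_fst)).const_smul ε).sub
      (measurable_snd.smul (measurable_fst.comp measurable_fst))).prodMk (measurable_fst.comp measurable_fst)
  -- Tonelli: `w` outer, `q` inner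
  have h1 : ∫⁻ z in billiardGood ε, F z = ∫⁻ w, ∫⁻ q, (billiardGood ε).indicator F (q, w) := by
    rw [← lintegral_indicator hbG, Measure.volume_eq_prod, lintegral_prod_symm _ (hF.indicator hbG).aemeasurable]
  -- the section at `w` is the incoming cylinder
  have h2 : ∀ w : EuclideanSpace ℝ (Fin 3), ∫⁻ q, (billiardGood ε).indicator F (q, w) =
      ∫⁻ ν : sphere (0 : EuclideanSpace ℝ (Fin 3)) 1, (∫⁻ τ in Ioi (0 : ℝ), K w ν τ) ∂(volume.toSphere) := by
    intro w
    have hsec : MeasurableSet {q : EuclideanSpace ℝ (Fin 3) | (q, w) ∈ (billiardGood ε :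
        Set (EuclideanSpace ℝ (Fin 3) × EuclideanSpace ℝ (Fin 3)))} :=
      hbG.preimage (measurable_id.prodMk measurable_const)
    have hind : (fun q => (billiardGood ε).indicator F (q, w)) =
        {q : EuclideanSpace ℝ (Fin 3) | (q, w) ∈ (billiardGood ε : Set (EuclideanSpace ℝ (Fin 3) ×
          EuclideanSpace ℝ (Fin 3)))}.indicator fun q => F (q, w) := by
      funext q; rfl
    rw [hind, lintegral_indicator hsec, setOf_mem_billiardGood_eq hε w,
      lintegral_collisionCylinder volume hε (-w) (fun q => F (q, w))
        (hF.comp (measurable_id.prodMk measurable_const))]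
    refine lintegral_congr fun ν => setLIntegral_congr_fun measurableSet_Ioi fun τ _ => ?_
    rw [hK]
    beta_reduce
    rw [finrank_E3, show (3 - 1 : ℕ) = 2 by norm_num, smul_neg, ← sub_eq_add_neg]
    by_cases hmem : (ν : EuclideanSpace ℝ (Fin 3)) ∈ collisionCylDom (-w)
    · rw [indicator_of_mem hmem, one_mul, ENNReal.ofReal_mul (sq_nonneg ε), inner_neg_left, mul_assoc]
    · have hle : ⟪-w, (ν : EuclideanSpace ℝ (Fin 3))⟫_ℝ ≤ 0 := not_lt.1 hmem
      rw [indicator_of_notMem hmem, zero_mul, ← inner_neg_left, ENNReal.ofReal_of_nonpos hle,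
        zero_mul, mul_zero]
  -- swap `w` with `ν`, then `w` with `τ`
  have hinner : Measurable fun p : EuclideanSpace ℝ (Fin 3) × sphere (0 : EuclideanSpace ℝ (Fin 3)) 1 =>
      ∫⁻ τ in Ioi (0 : ℝ), K p.1 p.2 τ := hKm.lintegral_prod_right'
  have h3 : ∫⁻ w, ∫⁻ ν : sphere (0 : EuclideanSpace ℝ (Fin 3)) 1, (∫⁻ τ in Ioi (0 : ℝ), K w ν τ)
      ∂(volume.toSphere) = ∫⁻ ν : sphere (0 : EuclideanSpace ℝ (Fin 3)) 1, (∫⁻ w, ∫⁻ τ in Ioi (0 : ℝ),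
        K w ν τ) ∂(volume.toSphere) :=
    lintegral_lintegral_swap hinner.aemeasurable
  have h4 : ∀ ν : sphere (0 : EuclideanSpace ℝ (Fin 3)) 1,
      ∫⁻ w, ∫⁻ τ in Ioi (0 : ℝ), K w ν τ = ∫⁻ τ in Ioi (0 : ℝ), ∫⁻ w, K w ν τ := by
    intro ν
    have hKν : Measurable fun p : EuclideanSpace ℝ (Fin 3) × ℝ => K p.1 ν p.2 :=
      hKm.comp ((measurable_fst.prodMk measurable_const).prodMk measurable_snd)
    exact lintegral_lintegral_swap hKν.aemeasurable
  rw [h1]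
  simp_rw [h2]
  rw [h3]
  simp_rw [h4]
  rw [hK]


/-- The hitting time is a measurable function of the relative datum. [folklore] -/
theorem measurable_pairHitTime (ε : ℝ) :
    Measurable fun z : EuclideanSpace ℝ (Fin 3) × EuclideanSpace ℝ (Fin 3) => pairHitTime ε z.1 z.2 := by
  unfold pairHitTime pairDisc
  fun_prop

/-- The hit point is a measurable function of the relative datum. [folklore] -/
theorem measurable_hitPoint (ε : ℝ) :
    Measurable fun z : EuclideanSpace ℝ (Fin 3) × EuclideanSpace ℝ (Fin 3) => hitPoint ε z := by
  unfold hitPoint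
  exact measurable_fst.add ((measurable_pairHitTime ε).smul measurable_snd)

/-- Reflecting across the plane orthogonal to `ε ν` is reflecting across the plane orthogonal to `ν`
(`ε ≠ 0`). [folklore] -/
theorem reflection_orthogonal_span_smul {ε : ℝ} (hε : ε ≠ 0) (ν y : W) :
    (ℝ ∙ (ε • ν))ᗮ.reflection y = (ℝ ∙ ν)ᗮ.reflection y := by
  rw [reflection_orthogonal_singleton_apply, reflection_orthogonal_singleton_apply, inner_smul_right,
    norm_smul, smul_smul, Real.norm_eq_abs, mul_pow, sq_abs]
  by_cases hν : ν = 0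
  · simp [hν]
  · congr 1
    have hn : ‖ν‖ ≠ 0 := norm_ne_zero_iff.2 hν
    field_simp

/-- **The Lambertian redraw of the incoming direction preserves Lebesgue measure on the billiard good
set** (two-body relative coordinates `(q, w) ∈ ℝ³ × ℝ³`): replacing the incoming relative velocity
`w` by `u = ‖w‖ ρ_n(lambertDir n ξ)` (`n` the contact normal, `ξ` standard Gaussian, `ρ_n` the
reflection across `nᗮ`) and the position `q = n − τ₀ w` by `n − τ₀ u` (same contact point, same hitting
time) maps `Leb|_{billiardGood} ⊗ γ` onto `Leb|_{billiardGood}`: for measurable `G ≥ 0`,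
`∫_{billiardGood} ∫ G(n − τ₀ u, u) dγ(ξ) d(q,w) = ∫_{billiardGood} G`. [folklore] -/
theorem lintegral_billiardGood_redraw {ε : ℝ} (hε : 0 < ε)
    {G : EuclideanSpace ℝ (Fin 3) × EuclideanSpace ℝ (Fin 3) → ℝ≥0∞} (hG : Measurable G) :
    ∫⁻ z in billiardGood ε, (∫⁻ ξ, G (hitPoint ε z - pairHitTime ε z.1 z.2 •
        (‖z.2‖ • (lambertDir (hitPoint ε z) ξ - (2 * ⟪lambertDir (hitPoint ε z) ξ, hitPoint ε z⟫_ℝ / ‖hitPoint ε z‖ ^ 2) • hitPoint ε z)),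
          ‖z.2‖ • (lambertDir (hitPoint ε z) ξ - (2 * ⟪lambertDir (hitPoint ε z) ξ, hitPoint ε z⟫_ℝ / ‖hitPoint ε z‖ ^ 2) • hitPoint ε z))
            ∂(stdGaussian (EuclideanSpace ℝ (Fin 3)))) =
      ∫⁻ z in billiardGood ε, G z := by
  -- the redrawn datum, with the reflection written out
  obtain ⟨EL, hEL⟩ : ∃ EL : EuclideanSpace ℝ (Fin 3) → EuclideanSpace ℝ (Fin 3) × EuclideanSpace ℝ (Fin 3) →
      EuclideanSpace ℝ (Fin 3) × EuclideanSpace ℝ (Fin 3), EL = fun ξ z =>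
        (hitPoint ε z - pairHitTime ε z.1 z.2 • (‖z.2‖ • (lambertDir (hitPoint ε z) ξ -
          (2 * ⟪lambertDir (hitPoint ε z) ξ, hitPoint ε z⟫_ℝ / ‖hitPoint ε z‖ ^ 2) • hitPoint ε z)),
         ‖z.2‖ • (lambertDir (hitPoint ε z) ξ -
          (2 * ⟪lambertDir (hitPoint ε z) ξ, hitPoint ε z⟫_ℝ / ‖hitPoint ε z‖ ^ 2) • hitPoint ε z)) :=
    ⟨_, rfl⟩
  have hELm : Measurable fun p : (EuclideanSpace ℝ (Fin 3) × EuclideanSpace ℝ (Fin 3)) ×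
      EuclideanSpace ℝ (Fin 3) => EL p.2 p.1 := by
    rw [hEL]
    have hn : Measurable fun p : (EuclideanSpace ℝ (Fin 3) × EuclideanSpace ℝ (Fin 3)) ×
        EuclideanSpace ℝ (Fin 3) => hitPoint ε p.1 := (measurable_hitPoint ε).comp measurable_fst
    have hτ : Measurable fun p : (EuclideanSpace ℝ (Fin 3) × EuclideanSpace ℝ (Fin 3)) ×
        EuclideanSpace ℝ (Fin 3) => pairHitTime ε p.1.1 p.1.2 := (measurable_pairHitTime ε).comp measurable_fst
    have hd : Measurable fun p : (EuclideanSpace ℝ (Fin 3) × EuclideanSpace ℝ (Fin 3)) ×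
        EuclideanSpace ℝ (Fin 3) => lambertDir (hitPoint ε p.1) p.2 := hn.lambertDir measurable_snd
    have hu : Measurable fun p : (EuclideanSpace ℝ (Fin 3) × EuclideanSpace ℝ (Fin 3)) ×
        EuclideanSpace ℝ (Fin 3) => ‖p.1.2‖ • (lambertDir (hitPoint ε p.1) p.2 -
          (2 * ⟪lambertDir (hitPoint ε p.1) p.2, hitPoint ε p.1⟫_ℝ / ‖hitPoint ε p.1‖ ^ 2) • hitPoint ε p.1) :=
      (measurable_snd.comp measurable_fst).norm.smul (hd.sub (((measurable_const.mul (hd.inner hn)).div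
        (hn.norm.pow_const 2)).smul hn))
    exact (hn.sub (hτ.smul hu)).prodMk hu
  have hF₁ : Measurable fun z : EuclideanSpace ℝ (Fin 3) × EuclideanSpace ℝ (Fin 3) =>
      ∫⁻ ξ, G (EL ξ z) ∂(stdGaussian (EuclideanSpace ℝ (Fin 3))) :=
    (hG.comp hELm).lintegral_prod_right'
  have hstep : ∫⁻ z in billiardGood ε, (∫⁻ ξ, G (hitPoint ε z - pairHitTime ε z.1 z.2 •
      (‖z.2‖ • (lambertDir (hitPoint ε z) ξ -
        (2 * ⟪lambertDir (hitPoint ε z) ξ, hitPoint ε z⟫_ℝ / ‖hitPoint ε z‖ ^ 2) • hitPoint ε z)),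
      ‖z.2‖ • (lambertDir (hitPoint ε z) ξ -
        (2 * ⟪lambertDir (hitPoint ε z) ξ, hitPoint ε z⟫_ℝ / ‖hitPoint ε z‖ ^ 2) • hitPoint ε z))
          ∂(stdGaussian (EuclideanSpace ℝ (Fin 3)))) =
      ∫⁻ z in billiardGood ε, (∫⁻ ξ, G (EL ξ z) ∂(stdGaussian (EuclideanSpace ℝ (Fin 3)))) := by
    rw [hEL]
  rw [hstep, lintegral_billiardGood_eq_cylinder hε hF₁, lintegral_billiardGood_eq_cylinder hε hG]
  refine lintegral_congr fun ν => setLIntegral_congr_fun measurableSet_Ioi fun τ hτ => ?_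
  have hτ : 0 < τ := hτ
  have hν : ‖(ν : EuclideanSpace ℝ (Fin 3))‖ = 1 := by simp
  -- the function of the redrawn velocity
  set h : EuclideanSpace ℝ (Fin 3) → ℝ≥0∞ := fun y => G (ε • (ν : EuclideanSpace ℝ (Fin 3)) - τ • y, y) with hh
  have hhm : Measurable h := hG.comp (((measurable_const).sub (measurable_id.const_smul τ)).prodMk measurable_id)
  have hflux := lintegral_flux_redraw hν hhm
  simp_rw [reflection_orthogonal_singleton_apply] at hflux
  have hmeas1 : Measurable fun w : EuclideanSpace ℝ (Fin 3) => ENNReal.ofReal (-⟪w, (ν : EuclideanSpace ℝ (Fin 3))⟫_ℝ) *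
      ∫⁻ ξ, G (EL ξ (ε • (ν : EuclideanSpace ℝ (Fin 3)) - τ • w, w)) ∂(stdGaussian (EuclideanSpace ℝ (Fin 3))) :=
    (measurable_id.inner measurable_const).neg.ennreal_ofReal.mul
      (hF₁.comp ((measurable_const.sub (measurable_id.const_smul τ)).prodMk measurable_id))
  have hmeas2 : Measurable fun w : EuclideanSpace ℝ (Fin 3) => ENNReal.ofReal (-⟪w, (ν : EuclideanSpace ℝ (Fin 3))⟫_ℝ) *
      G (ε • (ν : EuclideanSpace ℝ (Fin 3)) - τ • w, w) :=
    (measurable_id.inner measurable_const).neg.ennreal_ofReal.mul hhm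
  rw [lintegral_const_mul _ hmeas1, lintegral_const_mul _ hmeas2]
  congr 1
  rw [← hflux]
  refine lintegral_congr fun w => ?_
  by_cases hw : ⟪w, (ν : EuclideanSpace ℝ (Fin 3))⟫_ℝ < 0
  · congr 1
    rw [hEL, hh]
    refine lintegral_congr fun ξ => ?_
    dsimp only
    rw [hitPoint_of_cylinder hε hν hw hτ, (billiardGood_of_cylinder hε hν hw hτ).2, lambertDir_smul_left hε,
      inner_smul_right, norm_smul, Real.norm_of_nonneg hε.le, hν, mul_one, one_pow, div_one, smul_smul _ ε]
    have hc : 2 * (ε * ⟪lambertDir (ν : EuclideanSpace ℝ (Fin 3)) ξ, (ν : EuclideanSpace ℝ (Fin 3))⟫_ℝ) /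
        ε ^ 2 * ε = 2 * ⟪lambertDir (ν : EuclideanSpace ℝ (Fin 3)) ξ, (ν : EuclideanSpace ℝ (Fin 3))⟫_ℝ := by
      field_simp
    rw [hc]
  · have h0 : ENNReal.ofReal (-⟪w, (ν : EuclideanSpace ℝ (Fin 3))⟫_ℝ) = 0 :=
      ENNReal.ofReal_of_nonpos (by linarith [not_lt.1 hw])
    rw [h0, zero_mul, zero_mul]


end Cylinder


end HalfAngle

end Summit.AtomisticToContinuum.HydrodynamicLimit.Theorems
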